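import Mathlib
import Summits.ABC.ABC.Statement
import HarnessLib

/-!
# Fixed signatures of the generic ω = 3 equations are finite, given Darmon–Granville (solo-blind seat, session 5)

The generic three-prime-power equations of the first open support `{2, q, r}` are `2^l + q^m = rⁿ` (shape A) and
`p^l + q^m = 2ⁿ` (shape B).  Writing the power of two as `2^i · (2^j)^E` for ANY auxiliary exponent `E` turns a triple
with fixed odd-base exponents into a proper solution of a generalised Fermat equation `A x^E + B y^m = C z^n` with
`(A, B, C) ∈ {(2^i, 1, 1), (1, 1, 2^i)}`; so Darmon–Granville's Theorem 2 (named, unproved Literature fact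
`darmonGranville1995_thm_2`, used as a hypothesis) gives: for fixed odd-base exponents admitting a hyperbolic
completion, each shape has only finitely many triples with odd coprime bases.  The common exponent the Frey /
Darmon–Granville machinery needs is free at ω = 3.

* `shapeA_signature_finite` : `(h : darmonGranville1995_thm_2)`, `m n + n E + E m < E m n` ⇒
  `{(l, q, r) : q, r odd coprime, 2^l + q^m = rⁿ}` is finite.
* `shapeB_signature_finite` : `(h : darmonGranville1995_thm_2)`, `m E + E l + l m < l m E` ⇒
  `{(p, q, n) : p, q odd coprime, p^l + q^m = 2ⁿ}` is finite.
-/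

namespace Summit.ABC.ABC.Theorems

open Literature.NumberTheory.DiophantineGeometry

/-- If two members of `{x, y, z}` are coprime naturals then the (normalised) gcd of the finset is `1`. -/
private theorem finset_gcd_eq_one {x : ℤ} {q r : ℕ} (hqr : Nat.Coprime q r) :
    ({x, (q : ℤ), (r : ℤ)} : Finset ℤ).gcd id = 1 := by
  set s : Finset ℤ := {x, (q : ℤ), (r : ℤ)} with hs
  have hq : s.gcd id ∣ (q : ℤ) := Finset.gcd_dvd (f := id) (by simp [hs])
  have hr : s.gcd id ∣ (r : ℤ) := Finset.gcd_dvd (f := id) (by simp [hs])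
  have h1 : s.gcd id ∣ ((Nat.gcd q r : ℕ) : ℤ) := by
    rw [← Int.gcd_natCast_natCast]
    exact Int.dvd_coe_gcd hq hr
  rw [hqr, Nat.cast_one] at h1
  have hu : IsUnit (s.gcd id) := isUnit_of_dvd_one h1
  rw [← Finset.normalize_gcd]
  exact normalize_eq_one.mpr hu

/-- **Shape A, fixed signature.** Given Darmon–Granville, for exponents `m, n` and any auxiliary `E` with
`1/E + 1/m + 1/n < 1` there are only finitely many `(l, q, r)` with `q, r` odd and coprime and `2^l + q^m = rⁿ`. -/
theorem shapeA_signature_finite (hDG : darmonGranville1995_thm_2) {m n E : ℕ} (hE : 0 < E)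
    (hyp : m * n + n * E + E * m < E * m * n) :
    {t : ℕ × ℕ × ℕ | Odd t.2.1 ∧ Odd t.2.2 ∧ Nat.Coprime t.2.1 t.2.2 ∧ 2 ^ t.1 + t.2.1 ^ m = t.2.2 ^ n}.Finite := by
  set S := {t : ℕ × ℕ × ℕ | Odd t.2.1 ∧ Odd t.2.2 ∧ Nat.Coprime t.2.1 t.2.2 ∧ 2 ^ t.1 + t.2.1 ^ m = t.2.2 ^ n}
    with hSdef
  -- the Darmon–Granville sets for `2^i x^E + y^m = z^n`, `i < E`
  let F : Fin E → Set (ℤ × ℤ × ℤ) := fun i =>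
    {u : ℤ × ℤ × ℤ | ({u.1, u.2.1, u.2.2} : Finset ℤ).gcd id = 1 ∧
      (2 : ℤ) ^ (i : ℕ) * u.1 ^ E + 1 * u.2.1 ^ m = 1 * u.2.2 ^ n}
  have hF : ∀ i, (F i).Finite := fun i =>
    hDG ((2 : ℤ) ^ (i : ℕ)) 1 1 (pow_ne_zero _ two_ne_zero) one_ne_zero one_ne_zero (p := E) (q := m) (r := n)
      (by linarith)
  have hU : (⋃ i, F i ×ˢ ({i} : Set (Fin E))).Finite :=
    Set.finite_iUnion fun i => (hF i).prod (Set.finite_singleton i)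
  -- the injection `(l, q, r) ↦ ((2^(l/E), q, r), l % E)`
  let g : ℕ × ℕ × ℕ → (ℤ × ℤ × ℤ) × Fin E := fun t =>
    ((((2 ^ (t.1 / E) : ℕ) : ℤ), (t.2.1 : ℤ), (t.2.2 : ℤ)), ⟨t.1 % E, Nat.mod_lt _ hE⟩)
  have hg : Set.InjOn g S := by
    rintro ⟨l, q, r⟩ - ⟨l', q', r'⟩ - h
    simp only [g, Prod.mk.injEq, Nat.cast_inj, Fin.mk.injEq] at h
    obtain ⟨⟨h1, h2, h3⟩, h4⟩ := h
    have h1' : l / E = l' / E := Nat.pow_right_injective (le_refl 2) h1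
    have : l = l' := by rw [← Nat.div_add_mod l E, ← Nat.div_add_mod l' E, h1', h4]
    subst this; subst h2; subst h3; rfl
  have himg : g '' S ⊆ ⋃ i, F i ×ˢ ({i} : Set (Fin E)) := by
    rintro _ ⟨⟨l, q, r⟩, ht, rfl⟩
    obtain ⟨-, -, hcop, h⟩ := ht
    simp only [Set.mem_iUnion, Set.mem_prod, Set.mem_singleton_iff]
    refine ⟨⟨l % E, Nat.mod_lt _ hE⟩, ?_, rfl⟩
    refine ⟨finset_gcd_eq_one hcop, ?_⟩
    have key : (2 : ℤ) ^ (l % E) * ((2 : ℤ) ^ (l / E)) ^ E + (q : ℤ) ^ m = (r : ℤ) ^ n := by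
      rw [← pow_mul, ← pow_add, Nat.mod_add_div' l E]
      exact_mod_cast h
    simp only [g, one_mul]
    push_cast
    exact key
  exact Set.Finite.of_finite_image (hU.subset himg) hg

/-- **Shape B, fixed signature.** Given Darmon–Granville, for exponents `l, m` and any auxiliary `E` with
`1/l + 1/m + 1/E < 1` there are only finitely many `(p, q, n)` with `p, q` odd and coprime and `p^l + q^m = 2ⁿ`. -/
theorem shapeB_signature_finite (hDG : darmonGranville1995_thm_2) {l m E : ℕ} (hE : 0 < E)
    (hyp : m * E + E * l + l * m < l * m * E) :
    {t : ℕ × ℕ × ℕ | Odd t.1 ∧ Odd t.2.1 ∧ Nat.Coprime t.1 t.2.1 ∧ t.1 ^ l + t.2.1 ^ m = 2 ^ t.2.2}.Finite := by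
  set S := {t : ℕ × ℕ × ℕ | Odd t.1 ∧ Odd t.2.1 ∧ Nat.Coprime t.1 t.2.1 ∧ t.1 ^ l + t.2.1 ^ m = 2 ^ t.2.2}
    with hSdef
  -- the Darmon–Granville sets for `x^l + y^m = 2^i z^E`, `i < E`
  let F : Fin E → Set (ℤ × ℤ × ℤ) := fun i =>
    {u : ℤ × ℤ × ℤ | ({u.1, u.2.1, u.2.2} : Finset ℤ).gcd id = 1 ∧
      1 * u.1 ^ l + 1 * u.2.1 ^ m = (2 : ℤ) ^ (i : ℕ) * u.2.2 ^ E}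
  have hF : ∀ i, (F i).Finite := fun i =>
    hDG 1 1 ((2 : ℤ) ^ (i : ℕ)) one_ne_zero one_ne_zero (pow_ne_zero _ two_ne_zero) (p := l) (q := m) (r := E)
      (by linarith)
  have hU : (⋃ i, F i ×ˢ ({i} : Set (Fin E))).Finite :=
    Set.finite_iUnion fun i => (hF i).prod (Set.finite_singleton i)
  -- the injection `(p, q, n) ↦ ((p, q, 2^(n/E)), n % E)`
  let g : ℕ × ℕ × ℕ → (ℤ × ℤ × ℤ) × Fin E := fun t =>
    (((t.1 : ℤ), (t.2.1 : ℤ), ((2 ^ (t.2.2 / E) : ℕ) : ℤ)), ⟨t.2.2 % E, Nat.mod_lt _ hE⟩)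
  have hg : Set.InjOn g S := by
    rintro ⟨p, q, n⟩ - ⟨p', q', n'⟩ - h
    simp only [g, Prod.mk.injEq, Nat.cast_inj, Fin.mk.injEq] at h
    obtain ⟨⟨h1, h2, h3⟩, h4⟩ := h
    have h3' : n / E = n' / E := Nat.pow_right_injective (le_refl 2) h3
    have : n = n' := by rw [← Nat.div_add_mod n E, ← Nat.div_add_mod n' E, h3', h4]
    subst this; subst h1; subst h2; rfl
  have himg : g '' S ⊆ ⋃ i, F i ×ˢ ({i} : Set (Fin E)) := by
    rintro _ ⟨⟨p, q, n⟩, ht, rfl⟩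
    obtain ⟨-, -, hcop, h⟩ := ht
    simp only [Set.mem_iUnion, Set.mem_prod, Set.mem_singleton_iff]
    refine ⟨⟨n % E, Nat.mod_lt _ hE⟩, ?_, rfl⟩
    have hgcd : ({(p : ℤ), (q : ℤ), ((2 ^ (n / E) : ℕ) : ℤ)} : Finset ℤ).gcd id = 1 := by
      have hperm : ({(p : ℤ), (q : ℤ), ((2 ^ (n / E) : ℕ) : ℤ)} : Finset ℤ) =
          {((2 ^ (n / E) : ℕ) : ℤ), (p : ℤ), (q : ℤ)} := by
        ext x
        simp only [Finset.mem_insert, Finset.mem_singleton]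
        tauto
      rw [hperm]
      exact finset_gcd_eq_one hcop
    refine ⟨hgcd, ?_⟩
    have key : (p : ℤ) ^ l + (q : ℤ) ^ m = (2 : ℤ) ^ (n % E) * ((2 : ℤ) ^ (n / E)) ^ E := by
      rw [← pow_mul, ← pow_add, Nat.mod_add_div' n E]
      exact_mod_cast h
    simp only [g, one_mul]
    push_cast
    exact key
  exact Set.Finite.of_finite_image (hU.subset himg) hg

end Summit.ABC.ABC.Theorems
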